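import Literature.NumberTheory.GaloisRepresentations.PresentationGaloisModules
import Literature.NumberTheory.GaloisRepresentations.HomPermutationModuleVanishing
import HarnessLib

/-!
# The permutation cover `0 → X₂ → ℤ[Γ/U_E]ᵏ → X → 0` of a finite-type object of `C_Γ` trivialised by a layer, and
# the permutation structure of `ℤ[Γ/U_E]ᵏ` (permuted basis, uniform isotropy `U_E`, `H¹(K, Hom(ℤ[Γ/U_E]ᵏ, K̄ˣ)) = 0`)

Topic `NumberTheory/GaloisRepresentations`; namespace `Literature.NumberTheory.GaloisRepresentations.FreePresentation`.
Definitions with bodies (`coverHom`, `coverComplex`, the index set and basis of `presLattice E k` on its `LCarrier`) and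
theorems; no named fact, no instance, no notation, no `sorry`; number fields in `Type`.  Generalises door-c6 g17's
`PresentationGaloisModules` §3–§4 (stated there for the canonical presentation of a FINITE module: `presModuleBasis`,
`permutedBasis_presModule₂`, `uniformIsotropy_presIndex`) to the permutation lattice `presLattice E k = Inf ℤ[Γ_K/U_E]ᵏ`
of ANY layer `E` and rank `k`, and to covers of LATTICES.

THE MATHEMATICS (Milne ADT I, proof of Lemma 1.9: "every finitely generated `G`-module can be resolved by finitely
generated torsion-free modules"; proof of Lemma 4.13).  Let `X` be an object of door-c4's `C_Γ = DiscreteRepCat ℤ Γ_K` of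
finite type over `ℤ` on which `U_E = Gal(K̄/E)` acts trivially (a lattice trivialised by the layer `E`, e.g. the
relation module `N₁` of the canonical presentation of a finite module).  A finite generating family `g₁, …, g_k` of `X`
(`Module.Finite`) consists of `U_E`-invariants, so door-c4's `freePresentationHom` gives a surjection
`ℤ[Γ/U_E]ᵏ → X`, `e_{i,[σ]} ↦ σ gᵢ`, and a short exact **cover** `coverComplex E X : 0 → X₂ → presLattice E k → X → 0`
(`coverComplex_shortExact`), all of whose terms are of finite type and `U_E`-trivial.  The middle term has the
`Γ_K`-permuted basis `{e_{i,[σ]}}` indexed by `Fin k × Γ/U_E` (`permutedBasis_presLattice`) all of whose isotropy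
groups are `U_E` (`uniformIsotropy_presLatticeIndex`), hence (door-c6 F4b `HomPermutation.galoisCohomology_hom_units_eq_zero`)
**`H¹(K, Hom_ℤ(ℤ[Γ/U_E]ᵏ, K̄ˣ)) = 0`** (`galoisCohomology_hom_units_presLattice_eq_zero`: Shapiro + Hilbert 90), and
`Ext¹_{C_Γ}(ℤ[Γ/U_E]ᵏ, F̄ˣ) = 0 = Ext¹_{C_Γ}(ℤ[Γ/U_E]ᵏ, J̄)` (door-c6 F3, recalled as `ext_cover_*`).

USE: the cover of the relation lattice `N₁` is the dimension shift turning a class of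
`Ext¹_{C_Γ}(N₁, F̄ˣ) = H¹(K, Hom(N₁, K̄ˣ))` into an equivariant HOMOMORPHISM `X₂ → K̄ˣ` (door-c6 `dualδ₀_surjective`), on
which this seat's local-to-global extension principle (`IdeleExtensionLocalGlobal`, `IdeleTorusHasse`,
`HomDualPushforwardVanishing`) operates — input (B) of property (e) of the `Ш²`-readout road to `poitouTate_sha_tateDual`.
HONEST FRAMING: no case of Poitou–Tate or BSD is proved here.

## References
* J. S. Milne, *Arithmetic Duality Theorems* (2nd ed. 2006), I Lemma 1.9 (proof), I Lemma 4.13 (proof). [MilneADT2006]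
* K. S. Brown, *Cohomology of Groups*, GTM 87 (1982), III §5 Prop. (5.8). [Brown1982CohomologyGroups]
-/

noncomputable section

open CategoryTheory CategoryTheory.Limits
open Field (absoluteGaloisGroup)

namespace Literature.NumberTheory.GaloisRepresentations

namespace FreePresentation

open Literature.Algebra.Homology Literature.Algebra.Homology.DiscreteRep DiscreteGaloisModule IdeleClassBar DGMBridge
  HomPermutation

variable {K : Type} [Field K] [NumberField K] (E : GalLayer K)

/-! ## §1 The permutation structure of `presLattice E k` on its `LCarrier` -/

section Permutation

variable (k : ℕ)

/-- The index set `Fin k × Γ_K/U_E` of the standard basis of `presLattice E k` (a `Γ_K`-set by left translation).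
[cite: Brown1982CohomologyGroups, III §5] -/
abbrev PresLatticeIndex : Type :=
  Σ _ : Fin k, absoluteGaloisGroup K ⧸ (E.openNormalSubgroup : Subgroup (absoluteGaloisGroup K))

omit [NumberField K] in
/-- `γ • ⟨i, [τ]⟩ = ⟨i, [γ τ]⟩`. [cite: Brown1982CohomologyGroups, III §5] -/
theorem smul_presLatticeIndex_mk (γ τ : absoluteGaloisGroup K) (i : Fin k) :
    (γ • (⟨i, QuotientGroup.mk τ⟩ : PresLatticeIndex E k)) = ⟨i, QuotientGroup.mk (γ * τ)⟩ := rfl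

/-- **The standard basis of `presLattice E k` on the discrete carrier `LCarrier`**, indexed by `Fin k × Γ_K/U_E`
(door-c6 `presBasis`, transported along the identity `LCarrier.of`). [cite: MilneADT2006, I Lemma 1.9 (proof)] -/
def presLatticeBasis : Module.Basis (PresLatticeIndex E k) ℤ (LCarrier (presLattice E k)) :=
  (presBasis E k).map
    { toFun := LCarrier.of (presLattice E k)
      invFun := LCarrier.val (presLattice E k)
      map_add' := fun _ _ => rfl
      map_smul' := fun c x => by
        change LCarrier.of (presLattice E k) (c • x) = c • LCarrier.of (presLattice E k) x
        refine congrArg (fun i : Module ℤ (presLattice E k).obj.V =>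
          (show LCarrier (presLattice E k) from @HSMul.hSMul ℤ _ _ (@instHSMul ℤ _ i.toSMul) c x)) ?_
        exact Subsingleton.elim _ _
      left_inv := fun _ => rfl
      right_inv := fun _ => rfl }

omit [NumberField K] in
/-- `presLatticeBasis ⟨i, q⟩ = of (presBasis ⟨i, q⟩)`. [cite: MilneADT2006, I Lemma 1.9 (proof)] -/
theorem presLatticeBasis_apply (b : PresLatticeIndex E k) :
    presLatticeBasis E k b = LCarrier.of (presLattice E k) (presBasis E k b) := by
  rw [presLatticeBasis, Module.Basis.map_apply]
  rfl

omit [NumberField K] in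
/-- **The basis is permuted by `Γ_K`**: `σ · e⟨i, q⟩ = e⟨i, σ q⟩`. [cite: Brown1982CohomologyGroups, III §5 Prop. (5.8)] -/
theorem permutedBasis_presLattice : PermutedBasis K (toDGM (presLattice E k)) (presLatticeBasis E k) := by
  rintro γ ⟨i, q⟩
  induction q using QuotientGroup.induction_on with
  | H τ =>
    rw [smul_presLatticeIndex_mk, presLatticeBasis_apply, presLatticeBasis_apply, toDGM_apply, LCarrier.val_of,
      presBasis_apply, presBasis_apply]
    exact congrArg (LCarrier.of (presLattice E k)) (Representation.free_single_single _ _ _ _)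

omit [NumberField K] in
/-- **Uniform isotropy**: every isotropy group of `Γ_K` on `Fin k × Γ_K/U_E` is `Gal(K̄/E) = U_E`.
[cite: Brown1982CohomologyGroups, III §5 Prop. (5.8)] -/
theorem uniformIsotropy_presLatticeIndex :
    haveI := E.isGalois
    UniformIsotropy K (PresLatticeIndex E k) E.1 := by
  haveI := E.isGalois
  rintro ⟨i, q⟩
  induction q using QuotientGroup.induction_on with
  | H τ =>
    ext γ
    rw [MulAction.mem_stabilizer_iff, smul_presLatticeIndex_mk, mem_absGaloisFixingSubgroup_iff]
    constructor
    · intro h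
      have h' : (QuotientGroup.mk (γ * τ) : absoluteGaloisGroup K ⧸
          (E.openNormalSubgroup : Subgroup (absoluteGaloisGroup K))) = QuotientGroup.mk τ :=
        (Sigma.mk.inj_iff.1 h).2 |> eq_of_heq
      rw [QuotientGroup.eq] at h'
      have hγ : γ ∈ (E.openNormalSubgroup : Subgroup (absoluteGaloisGroup K)) := by
        have h1 : τ * ((γ * τ)⁻¹ * τ) * τ⁻¹ ∈ (E.openNormalSubgroup : Subgroup (absoluteGaloisGroup K)) :=
          Subgroup.Normal.conj_mem inferInstance _ h' τ
        rw [mul_inv_rev, show τ * (τ⁻¹ * γ⁻¹ * τ) * τ⁻¹ = γ⁻¹ by group] at h1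
        exact (Subgroup.inv_mem_iff _).1 h1
      exact fun x hx => (IntermediateField.mem_fixingSubgroup_iff _ _).1 hγ x hx
    · intro h
      have hγ : γ ∈ (E.openNormalSubgroup : Subgroup (absoluteGaloisGroup K)) :=
        (IntermediateField.mem_fixingSubgroup_iff _ _).2 h
      have h' : (QuotientGroup.mk (γ * τ) : absoluteGaloisGroup K ⧸
          (E.openNormalSubgroup : Subgroup (absoluteGaloisGroup K))) = QuotientGroup.mk τ := by
        rw [QuotientGroup.eq, mul_inv_rev]
        have h1 : τ⁻¹ * γ⁻¹ * τ⁻¹⁻¹ ∈ (E.openNormalSubgroup : Subgroup (absoluteGaloisGroup K)) :=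
          Subgroup.Normal.conj_mem inferInstance _ ((Subgroup.inv_mem_iff _).2 hγ) τ⁻¹
        simpa only [inv_inv, mul_assoc] using h1
      rw [h']

/-- `LCarrier (presLattice E k)` is a finitely generated `ℤ`-module. [cite: MilneADT2006, I Lemma 1.9 (proof)] -/
theorem moduleFinite_lcarrier_presLattice : Module.Finite ℤ (LCarrier (presLattice E k)) :=
  moduleFinite_lcarrier _ (moduleFinite_presLattice E k)

/-- **`H¹(K, Hom_ℤ(ℤ[Γ/U_E]ᵏ, K̄ˣ)) = 0`** (door-c6 F4b `galoisCohomology_hom_units_eq_zero` — Shapiro and Hilbert 90 at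
the layers — for the permutation structure above). [cite: MilneADT2006, I Lemma 4.13 (proof)] -/
theorem galoisCohomology_hom_units_presLattice_eq_zero
    (ζ : haveI := moduleFinite_lcarrier_presLattice E k
      galoisCohomology (homGaloisModule (toDGM (presLattice E k)) (units K)) 1) : ζ = 0 := by
  haveI := moduleFinite_lcarrier_presLattice E k
  haveI := E.isGalois
  haveI := E.finiteDimensional
  exact galoisCohomology_hom_units_eq_zero (uniformIsotropy_presLatticeIndex E k) (permutedBasis_presLattice E k) ζ

end Permutation

/-! ## §2 The permutation cover of a finite-type `U_E`-trivial object -/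

section Cover

-- As in door-c4's `DiscreteRepFreePresentation`: on the vectors `X.obj.V` of an object of `Rep ℤ Γ` the representation's
-- own `Module ℤ` structure `Rep.hV2` is the preferred one in this section (a structure field made a local instance; no
-- library instance is overridden), so that spans in `X^U` are taken for the structure `freePresentation_shortExact` uses.
attribute [local instance 10000] Rep.hV2

variable (X : DiscreteRepCat ℤ (absoluteGaloisGroup K)) [Module.Finite ℤ (LCarrier X)]
  (hX : ∀ σ ∈ E.openNormalSubgroup, ∀ x : X.obj.V, X.obj.ρ σ x = x)

omit [NumberField K] in
/-- `X.obj.V` is finitely generated for the representation's own `ℤ`-structure (all `ℤ`-structures agree).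
[cite: MilneADT2006, I Lemma 1.9 (proof)] -/
theorem moduleFinite_obj : Module.Finite ℤ X.obj.V := by
  have h : X.obj.hV2 = AddCommGroup.toIntModule X.obj.V := Subsingleton.elim _ _
  rw [h]
  exact (inferInstance : Module.Finite ℤ (LCarrier X))

omit [NumberField K] in
/-- **A finite spanning family of `U_E`-invariants of `X`** (a finite generating family exists by `Module.Finite`: the
invariants form a submodule of a Noetherian `ℤ`-module). [cite: MilneADT2006, I Lemma 1.9 (proof)] -/
theorem exists_coverGens : ∃ (k : ℕ)
    (s : Fin k → ((invariantsQuotFunctor ℤ (E.openNormalSubgroup : Subgroup (absoluteGaloisGroup K))).obj X).V),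
    Submodule.span ℤ (Set.range s) = ⊤ := by
  haveI : Module.Finite ℤ X.obj.V := moduleFinite_obj X
  haveI : IsNoetherian ℤ ((DiscreteRep.ι ℤ (absoluteGaloisGroup K)).obj X).V :=
    isNoetherian_of_isNoetherianRing_of_finite ℤ X.obj.V
  haveI : Module.Finite ℤ ((invariantsQuotFunctor ℤ (E.openNormalSubgroup : Subgroup (absoluteGaloisGroup K))).obj X).V :=
    Module.Finite.iff_fg.mpr (IsNoetherian.noetherian _)
  exact Module.Finite.exists_fin

/-- The rank `k` of the cover. [cite: MilneADT2006, I Lemma 1.9 (proof)] -/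
def coverRank : ℕ := (exists_coverGens E X).choose

/-- The generators of the cover. [cite: MilneADT2006, I Lemma 1.9 (proof)] -/
def coverGens :
    Fin (coverRank E X) → ((invariantsQuotFunctor ℤ (E.openNormalSubgroup : Subgroup (absoluteGaloisGroup K))).obj X).V :=
  (exists_coverGens E X).choose_spec.choose

omit [NumberField K] in
/-- The generators span. [cite: MilneADT2006, I Lemma 1.9 (proof)] -/
theorem span_coverGens : Submodule.span ℤ (Set.range (coverGens E X)) = ⊤ :=
  (exists_coverGens E X).choose_spec.choose_spec

/-- **The surjection `presLattice E k ⟶ X` of the cover** (door-c4 `freePresentationHom` on the generators).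
[cite: MilneADT2006, I Lemma 1.9 (proof)] -/
def coverHom : presLattice E (coverRank E X) ⟶ X :=
  freePresentationHom (E.openNormalSubgroup : Subgroup (absoluteGaloisGroup K))
    (LayerColimit.coe_isOpen E.openNormalSubgroup) X (coverGens E X)

/-- **The cover `0 → X₂ → presLattice E k → X → 0`** (`X₂ = ker`). [cite: MilneADT2006, I Lemma 1.9 (proof)] -/
def coverComplex : ShortComplex (DiscreteRepCat ℤ (absoluteGaloisGroup K)) :=
  ShortComplex.mk (kernel.ι (coverHom E X)) (coverHom E X) (kernel.condition _)

omit [NumberField K] in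
/-- `X₂` of the cover is `presLattice E k` (definitionally). [cite: MilneADT2006, I Lemma 1.9 (proof)] -/
theorem coverComplex_X₂ : (coverComplex E X).X₂ = presLattice E (coverRank E X) := rfl

omit [NumberField K] in
/-- `X₃` of the cover is `X` (definitionally). [cite: MilneADT2006, I Lemma 1.9 (proof)] -/
theorem coverComplex_X₃ : (coverComplex E X).X₃ = X := rfl

omit [NumberField K] in
include hX in
/-- **The cover is short exact.** [cite: MilneADT2006, I Lemma 1.9 (proof)] -/
theorem coverComplex_shortExact : (coverComplex E X).ShortExact :=
  freePresentation_shortExact (E.openNormalSubgroup : Subgroup (absoluteGaloisGroup K))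
    (LayerColimit.coe_isOpen E.openNormalSubgroup) X (coverGens E X) (span_coverGens E X) (fun _ hu x => hX _ hu x)

omit [NumberField K] in
include hX in
/-- `S.f = kernel.ι` of the cover is injective on vectors. [cite: MilneADT2006, I Lemma 1.9 (proof)] -/
theorem coverComplex_f_injective : Function.Injective (coverComplex E X).f.hom.hom :=
  (Rep.mono_iff_injective ((DiscreteRep.ι ℤ (absoluteGaloisGroup K)).map (coverComplex E X).f)).1
    (by
      haveI := (coverComplex_shortExact E X hX).mono_f
      infer_instance)

omit [NumberField K] in
/-- `U_E` acts trivially on the middle term of the cover. [cite: MilneADT2006, I Lemma 1.9 (proof)] -/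
theorem coverComplex_X₂_trivial :
    ∀ σ ∈ E.openNormalSubgroup, ∀ x : (coverComplex E X).X₂.obj.V, (coverComplex E X).X₂.obj.ρ σ x = x :=
  trivialOn_presLattice E (coverRank E X)

omit [NumberField K] in
include hX in
/-- **`U_E` acts trivially on the kernel `X₂` of the cover** (a subobject of the `U_E`-trivial `presLattice`).
[cite: MilneADT2006, I Lemma 1.9 (proof)] -/
theorem coverComplex_X₁_trivial :
    ∀ σ ∈ E.openNormalSubgroup, ∀ x : (coverComplex E X).X₁.obj.V, (coverComplex E X).X₁.obj.ρ σ x = x :=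
  fun σ hσ x => by
    apply coverComplex_f_injective E X hX
    rw [Rep.hom_comm_apply]
    exact trivialOn_presLattice E (coverRank E X) σ hσ _

omit [NumberField K] in
include hX in
/-- `U_E` acts trivially on `X₃ = X`. [cite: MilneADT2006, I Lemma 1.9 (proof)] -/
theorem coverComplex_X₃_trivial :
    ∀ σ ∈ E.openNormalSubgroup, ∀ x : (coverComplex E X).X₃.obj.V, (coverComplex E X).X₃.obj.ρ σ x = x := hX

/-- The middle term of the cover is of finite type (on `LCarrier`). [cite: MilneADT2006, I Lemma 1.9 (proof)] -/
theorem moduleFinite_coverComplex_X₂ : Module.Finite ℤ (LCarrier (coverComplex E X).X₂) :=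
  moduleFinite_lcarrier_presLattice E (coverRank E X)

include hX in
/-- The kernel of the cover is of finite type (on `LCarrier`). [cite: MilneADT2006, I Lemma 1.9 (proof)] -/
theorem moduleFinite_coverComplex_X₁ : Module.Finite ℤ (LCarrier (coverComplex E X).X₁) := by
  haveI := (coverComplex_shortExact E X hX).mono_f
  exact moduleFinite_lcarrier _
    (moduleFinite_of_mono (coverComplex E X).f (moduleFinite_presLattice E (coverRank E X)))

omit [NumberField K] in
/-- `X₃ = X` of the cover is of finite type (on `LCarrier`; the given instance). [cite: MilneADT2006, I Lemma 1.9 (proof)] -/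
theorem moduleFinite_coverComplex_X₃ : Module.Finite ℤ (LCarrier (coverComplex E X).X₃) :=
  (inferInstance : Module.Finite ℤ (LCarrier X))

/-- **`Ext¹_{C_Γ}(X₂-term of the cover, F̄ˣ) = 0`** (Hilbert 90 at the layers, door-c6 F3).
[cite: MilneADT2006, I Lemma 4.13 (proof)] -/
theorem ext_cover_unitsBarD_eq_zero (x : Abelian.Ext (coverComplex E X).X₂ (unitsBarD K) 1) : x = 0 :=
  ext_presLattice_unitsBarD_eq_zero E (coverRank E X) x

/-- **`Ext¹_{C_Γ}(X₂-term of the cover, J̄) = 0`** (idèle Hilbert 90 at the layers, door-c6 F3).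
[cite: MilneADT2006, I Lemma 4.13 (proof)] -/
theorem ext_cover_ideleBarD_eq_zero (x : Abelian.Ext (coverComplex E X).X₂ (ideleBarD K) 1) : x = 0 :=
  ext_presLattice_ideleBarD_eq_zero E (coverRank E X) x

/-- **`H¹(K, Hom_ℤ(X₂-term of the cover, K̄ˣ)) = 0`** (the hypothesis of door-c6 `dualδ₀_surjective` for the cover).
[cite: MilneADT2006, I Lemma 4.13 (proof)] -/
theorem galoisCohomology_hom_units_cover_eq_zero
    (ζ : haveI := moduleFinite_coverComplex_X₂ E X
      galoisCohomology (homGaloisModule (toDGM (coverComplex E X).X₂) (units K)) 1) : ζ = 0 :=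
  galoisCohomology_hom_units_presLattice_eq_zero E (coverRank E X) ζ

end Cover

end FreePresentation

end Literature.NumberTheory.GaloisRepresentations

end
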